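import Mathlib
import Summits.ValiantsHypothesis.ValiantsHypothesis.Theorems.ProofCarryingSymmetryRestorationQPPCRealizable

/-!
# Route ProofCarryingSymmetry — crux `RestorationQP`, line `registered`: the comb calculus of proof DAGs

Necessity of the provability stub T′ (`stub_invarianceProvableQP'`), part 2.  Deep
associative–commutative rewriting inside LEFT COMBS `((a ∘ x₁) ∘ x₂) ∘ ⋯ ∘ x_k` (`PCR.comb`), as
proof DAGs (`PCR.Real`, part 1) of explicitly polynomial size, for either operation of a
Hrubeš–Tzameret system (an `OpKit`: the operation with its commutativity/associativity schemes,
its congruence rule and its size law):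

* `Real.combCongrAcc` — replacing the accumulator: `a = a' ⊢ comb a l = comb a' l`
  (`≤ 4·B·|l|`, `B` a bound on the weight `W a l = |comb a l|`);
* `Real.combCongrList` — replacing the entries pointwise;
* `Real.swapBottom` — `(a ∘ x) ∘ y = (a ∘ y) ∘ x` (`≤ 16 B`);
* `Real.commutePast` — `comb (a ∘ x) p = (comb a p) ∘ x` (`≤ 24·B·(|p|+1)²`);
* `addKit`, `mulKit` — the two operation kits of `P_c(𝔽)`.

Part 2b (`…PCCombPerm`) derives permutation invariance of combs from these.  Everything generic in
the system; everything proved, no named facts.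
-/

-- single-problem summit: `Summit.ValiantsHypothesis.ValiantsHypothesis.…` is the namespace by design (D-0017)
set_option linter.dupNamespace false

namespace Summit.ValiantsHypothesis.ValiantsHypothesis.Theorems

namespace PCR

open Literature.Computability.AlgebraicComplexity

universe u v w

variable {𝔽 : Type u} {T : Type w} [CommSemiring 𝔽] {S : PISystem 𝔽 T}

/-- One of the two operations of a proof system, packaged with what the comb calculus uses: its
commutativity and associativity axiom schemes, its congruence rule (R3 or R4) as a `Real`
extension, and the size law `|a ∘ b| = |a| + |b| + 1`. [folklore] -/
structure OpKit (S : PISystem 𝔽 T) where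
  /-- the operation (`S.add` or `S.mul`) -/
  op : T → T → T
  /-- A2/A4: `F ∘ G = G ∘ F` is an axiom instance -/
  comm : ∀ F G : T, ∃ s, S.IsAxiom s (op F G) (op G F)
  /-- A3/A5: `F ∘ (G ∘ H) = (F ∘ G) ∘ H` is an axiom instance -/
  assoc : ∀ F G H : T, ∃ s, S.IsAxiom s (op F (op G H)) (op (op F G) H)
  /-- R3/R4 as a proof-DAG extension -/
  congr : ∀ {L : List (T × T)} {n : ℕ} {F₁ G₁ F₂ G₂ : T}, Real S L n → (F₁, G₁) ∈ L → (F₂, G₂) ∈ L →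
    Real S ((op F₁ F₂, op G₁ G₂) :: L) (n + (S.size (op F₁ F₂) + S.size (op G₁ G₂)))
  /-- the size law -/
  size_op : ∀ a b : T, S.size (op a b) = S.size a + S.size b + 1

/-- The left comb `((a ∘ x₁) ∘ x₂) ∘ ⋯ ∘ x_k` with accumulator `a` over the list `[x₁, …, x_k]`.
[folklore] -/
def comb (K : OpKit S) (a : T) (l : List T) : T := l.foldl K.op a

/-- The weight of a comb: `|a| + Σ (|xᵢ| + 1)` — its size, independently of the order of the
entries. [folklore] -/
def W (S : PISystem 𝔽 T) (a : T) (l : List T) : ℕ := S.size a + (l.map fun x => S.size x + 1).sum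

/-- Unfolding of `comb` on the empty list. [folklore] -/
@[simp] theorem comb_nil (K : OpKit S) (a : T) : comb K a [] = a := rfl

/-- Unfolding of `comb` on a first entry. [folklore] -/
@[simp] theorem comb_cons (K : OpKit S) (a x : T) (l : List T) : comb K a (x :: l) = comb K (K.op a x) l := rfl

/-- Combs over a concatenation. [folklore] -/
theorem comb_append (K : OpKit S) (a : T) (l₁ l₂ : List T) :
    comb K a (l₁ ++ l₂) = comb K (comb K a l₁) l₂ := List.foldl_append

omit [CommSemiring 𝔽] in
/-- Unfolding of the weight on the empty list. [folklore] -/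
@[simp] theorem W_nil (a : T) : W S a [] = S.size a := by simp [W]

omit [CommSemiring 𝔽] in
/-- Unfolding of the weight on a first entry. [folklore] -/
theorem W_cons (a x : T) (l : List T) : W S a (x :: l) = S.size a + (S.size x + 1) + (l.map fun x => S.size x + 1).sum := by
  simp [W, add_assoc]

/-- Absorbing the first entry into the accumulator does not change the weight. [folklore] -/
theorem W_op (K : OpKit S) (a x : T) (l : List T) : W S (K.op a x) l = W S a (x :: l) := by
  simp [W, K.size_op]; ring

omit [CommSemiring 𝔽] in
/-- Weight over a concatenation. [folklore] -/
theorem W_append (a : T) (l₁ l₂ : List T) :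
    W S a (l₁ ++ l₂) = W S a l₁ + (l₂.map fun x => S.size x + 1).sum := by
  simp [W, add_assoc]

omit [CommSemiring 𝔽] in
/-- The weight is invariant under permutations of the entries. [folklore] -/
theorem W_perm (a : T) {l l' : List T} (h : l.Perm l') : W S a l = W S a l' := by
  simp only [W, (h.map fun x => S.size x + 1).sum_eq]

/-- **The size of a comb is its weight.** [folklore] -/
theorem size_comb (K : OpKit S) (a : T) (l : List T) : S.size (comb K a l) = W S a l := by
  induction l generalizing a with
  | nil => simp
  | cons x l ih => rw [comb_cons, ih, W_op]

omit [CommSemiring 𝔽] in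
/-- The accumulator weighs at most the comb. [folklore] -/
theorem size_le_W (a : T) (l : List T) : S.size a ≤ W S a l := Nat.le_add_right _ _

omit [CommSemiring 𝔽] in
/-- An entry weighs less than the comb. [folklore] -/
theorem size_lt_W_of_mem (a : T) {l : List T} {x : T} (hx : x ∈ l) : S.size x < W S a l := by
  have : S.size x + 1 ≤ (l.map fun x => S.size x + 1).sum :=
    List.single_le_sum (fun _ _ => Nat.zero_le _) _ (List.mem_map_of_mem hx)
  unfold W; omega

omit [CommSemiring 𝔽] in
/-- Moving an entry to the front does not change the weight. [folklore] -/
theorem W_middle (a x : T) (p q : List T) : W S a (p ++ x :: q) = W S a (x :: (p ++ q)) :=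
  W_perm a List.perm_middle

omit [CommSemiring 𝔽] in
/-- A prefix weighs at most the whole. [folklore] -/
theorem W_le_W_append (a : T) (l₁ l₂ : List T) : W S a l₁ ≤ W S a (l₁ ++ l₂) := by
  rw [W_append]; exact Nat.le_add_right _ _

/-! ### Replacing the accumulator and the entries -/

/-- **Replacing the accumulator of a comb**: from a realized line `a = a'`, realize
`comb a l = comb a' l`, at cost `≤ 4·B·|l|` for any bound `B` on the two weights. [folklore] -/
theorem Real.combCongrAcc (K : OpKit S) : ∀ (l : List T) {L : List (T × T)} {n : ℕ} {a a' : T}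
    (_ : Real S L n) (_ : (a, a') ∈ L) {B : ℕ} (_ : W S a l ≤ B) (_ : W S a' l ≤ B),
    Real S ((comb K a l, comb K a' l) :: L) (n + 4 * B * l.length)
  | [], L, n, a, a', h, hm, B, _, _ => by
    simpa using h.mono (List.cons_subset.2 ⟨hm, List.Subset.refl _⟩) le_rfl
  | x :: l, L, n, a, a', h, hm, B, hB, hB' => by
    have hx : S.size x < B := lt_of_lt_of_le (size_lt_W_of_mem (S := S) a List.mem_cons_self) hB
    have hax : S.size (K.op a x) ≤ B := by
      have := size_le_W (S := S) (K.op a x) l; rw [W_op] at this; omega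
    have hax' : S.size (K.op a' x) ≤ B := by
      have := size_le_W (S := S) (K.op a' x) l; rw [W_op] at this; omega
    have r1 := h.refl x
    have r2 := K.congr r1 (List.mem_cons_of_mem _ hm) List.mem_cons_self
    have r3 := Real.combCongrAcc K l r2 List.mem_cons_self (B := B) (by rw [W_op]; exact hB)
      (by rw [W_op]; exact hB')
    refine r3.mono (List.cons_subset_cons _ fun e he => ?_) ?_
    · exact List.mem_cons_of_mem _ (List.mem_cons_of_mem _ he)
    · simp only [List.length_cons]; nlinarith

/-- **Replacing the entries of a comb pointwise** (and the accumulator): from realized lines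
`a = a'` and `xᵢ = xᵢ'`, realize `comb a l = comb a' l'`, at cost `≤ 2·B·|l|`. [folklore] -/
theorem Real.combCongrList (K : OpKit S) : ∀ (l l' : List T) {L : List (T × T)} {n : ℕ} {a a' : T}
    (_ : Real S L n) (_ : (a, a') ∈ L) (_ : List.Forall₂ (fun x x' => (x, x') ∈ L) l l')
    {B : ℕ} (_ : W S a l ≤ B) (_ : W S a' l' ≤ B),
    Real S ((comb K a l, comb K a' l') :: L) (n + 2 * B * l.length)
  | [], l', L, n, a, a', h, hm, hl, B, _, _ => by
    cases hl
    simpa using h.mono (List.cons_subset.2 ⟨hm, List.Subset.refl _⟩) le_rfl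
  | x :: l, l', L, n, a, a', h, hm, hl, B, hB, hB' => by
    cases hl with
    | cons hx hl =>
      rename_i x' l'
      have hax : S.size (K.op a x) ≤ B := by
        have := size_le_W (S := S) (K.op a x) l; rw [W_op] at this; omega
      have hax' : S.size (K.op a' x') ≤ B := by
        have := size_le_W (S := S) (K.op a' x') l'; rw [W_op] at this; omega
      have r1 := K.congr h hm hx
      have r2 := Real.combCongrList K l l' r1 List.mem_cons_self
        (hl.imp fun _ _ hy => List.mem_cons_of_mem _ hy) (B := B) (by rw [W_op]; exact hB)
        (by rw [W_op]; exact hB')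
      refine r2.mono (List.cons_subset_cons _ fun e he => List.mem_cons_of_mem _ he) ?_
      simp only [List.length_cons]; nlinarith

/-! ### Swapping the two outermost entries -/

/-- **Bottom swap**: `(a ∘ x) ∘ y = (a ∘ y) ∘ x`, realized in eight lines
(assoc⁻¹, comm inside, assoc). [folklore] -/
theorem Real.swapBottom (K : OpKit S) {L : List (T × T)} {n : ℕ} (h : Real S L n) (a x y : T)
    {B : ℕ} (hB : S.size (K.op (K.op a x) y) ≤ B) :
    Real S ((K.op (K.op a x) y, K.op (K.op a y) x) :: L) (n + 16 * B) := by
  have hs : ∀ t, S.size t ≤ S.size (K.op (K.op a x) y) → S.size t ≤ B := fun t ht => ht.trans hB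
  simp only [K.size_op] at hs
  have ha := hs a (by omega)
  have h1 : S.size (K.op a (K.op x y)) ≤ B := hs _ (by simp only [K.size_op]; omega)
  have h2 : S.size (K.op (K.op a x) y) ≤ B := hs _ (by simp only [K.size_op]; omega)
  have h3 : S.size (K.op x y) ≤ B := hs _ (by simp only [K.size_op]; omega)
  have h4 : S.size (K.op y x) ≤ B := hs _ (by simp only [K.size_op]; omega)
  have h5 : S.size (K.op a (K.op y x)) ≤ B := hs _ (by simp only [K.size_op]; omega)
  have h6 : S.size (K.op (K.op a y) x) ≤ B := hs _ (by simp only [K.size_op]; omega)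
  obtain ⟨s₁, hax₁⟩ := K.assoc a x y
  obtain ⟨s₂, hax₂⟩ := K.comm x y
  obtain ⟨s₃, hax₃⟩ := K.assoc a y x
  -- 1: (a(xy), (ax)y)   2: ((ax)y, a(xy))   3: (xy, yx)   4: (a, a)   5: (a(xy), a(yx))
  -- 6: (a(yx), (ay)x)   7: ((ax)y, a(yx))   8: ((ax)y, (ay)x)
  have r1 := h.axm hax₁
  have r2 := r1.symm List.mem_cons_self
  have r3 := r2.axm hax₂
  have r4 := r3.refl a
  have r5 := K.congr r4 List.mem_cons_self (List.mem_cons_of_mem _ List.mem_cons_self)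
  have r6 := r5.axm hax₃
  have r7 := r6.trans
    (List.mem_cons_of_mem _ (List.mem_cons_of_mem _ (List.mem_cons_of_mem _
      (List.mem_cons_of_mem _ List.mem_cons_self))))
    (List.mem_cons_of_mem _ List.mem_cons_self)
  have r8 := r7.trans List.mem_cons_self (List.mem_cons_of_mem _ List.mem_cons_self)
  refine r8.mono (List.cons_subset_cons _ fun e he => ?_) (by omega)
  exact List.mem_cons_of_mem _ (List.mem_cons_of_mem _ (List.mem_cons_of_mem _
    (List.mem_cons_of_mem _ (List.mem_cons_of_mem _ (List.mem_cons_of_mem _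
    (List.mem_cons_of_mem _ he))))))

/-! ### Commuting an entry past a block -/

/-- **Commuting past**: `comb (a ∘ x) p = (comb a p) ∘ x` — the entry `x` is bubbled outward past
every entry of `p` (a bottom swap lifted through the rest of the comb, then recursion), at cost
`≤ 24·B·(|p|+1)²` for any bound `B` on the weight `W a (x :: p)`. [folklore] -/
theorem Real.commutePast (K : OpKit S) : ∀ (p : List T) {L : List (T × T)} {n : ℕ} (_ : Real S L n)
    (a x : T) {B : ℕ} (_ : W S a (x :: p) ≤ B),
    Real S ((comb K (K.op a x) p, K.op (comb K a p) x) :: L) (n + 24 * B * (p.length + 1) ^ 2)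
  | [], L, n, h, a, x, B, hB => by
    have hax : S.size (K.op a x) ≤ B := by rw [← W_nil (S := S), W_op]; exact hB
    simpa using (h.refl (K.op a x)).mono (List.Subset.refl _) (by nlinarith)
  | y :: p, L, n, h, a, x, B, hB => by
    -- weights of everything in play are `≤ B`
    have hW1 : W S (K.op (K.op a x) y) p ≤ B := by rwa [W_op, W_op]
    have hW2 : W S (K.op (K.op a y) x) p ≤ B := by
      rw [W_op, W_op, W_perm a (List.Perm.swap x y p)]; exact hB
    have hW3 : W S (K.op a y) (x :: p) ≤ B := by
      rw [W_op, W_perm a (List.Perm.swap x y p)]; exact hB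
    have hsz : S.size (K.op (K.op a x) y) ≤ B := (size_le_W (S := S) _ p).trans hW1
    have hc1 : S.size (comb K (K.op (K.op a x) y) p) ≤ B := by rw [size_comb]; exact hW1
    have hc3 : S.size (K.op (comb K (K.op a y) p) x) ≤ B := by
      have e : W S a (x :: y :: p) = W S (K.op a y) (p ++ [x]) := by
        rw [W_op]; exact W_perm a (perm_cons_append_singleton x y p)
      have := hB
      rw [e, W_append] at this
      rw [K.size_op, size_comb]
      simp only [List.map_cons, List.map_nil, List.sum_cons, List.sum_nil] at this
      omega
    -- 1: swap at the bottom; 2: lift through `p`; 3: recursion with accumulator `a ∘ y`; 4: chain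
    have r1 := h.swapBottom K a x y hsz
    have r2 := r1.combCongrAcc K p List.mem_cons_self hW1 hW2
    have r3 := Real.commutePast K p r2 (K.op a y) x hW3
    have r4 := r3.trans (List.mem_cons_of_mem _ List.mem_cons_self) List.mem_cons_self
    refine r4.mono (List.cons_subset_cons _ fun e he => ?_) ?_
    · exact List.mem_cons_of_mem _ (List.mem_cons_of_mem _ (List.mem_cons_of_mem _ he))
    · simp only [List.length_cons]
      nlinarith [hc1, hc3]
where
  /-- `x :: y :: p ~ y :: (p ++ [x])` -/
  perm_cons_append_singleton (x y : T) (p : List T) : (x :: y :: p).Perm (y :: (p ++ [x])) := by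
    have h1 : (x :: y :: p).Perm (y :: x :: p) := List.Perm.swap y x p
    have h2 : (x :: p).Perm (p ++ [x]) := List.perm_append_singleton x p |>.symm
    exact h1.trans (h2.cons y)

/-! ### The two operation kits of `P_c(𝔽)` -/

section PC

variable {K𝔽 : Type u} [CommSemiring K𝔽] {X : Type v}

/-- The `+` kit of `P_c(𝔽)`: disjoint sum, A2, A3, R3, `|F + G| = |F| + |G| + 1`. [folklore] -/
noncomputable def addKit (K𝔽 : Type u) [CommSemiring K𝔽] (X : Type v) : OpKit (pcSystem K𝔽 X) where
  op := PICircuit.add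
  comm F G := ⟨.A2, .inl (.a2 F G)⟩
  assoc F G H := ⟨.A3, .inl (.a3 F G H)⟩
  congr h h₁ h₂ := h.congrAdd h₁ h₂
  size_op := PICircuit.size_add

/-- The `×` kit of `P_c(𝔽)`: disjoint product, A4, A5, R4, `|F · G| = |F| + |G| + 1`. [folklore] -/
noncomputable def mulKit (K𝔽 : Type u) [CommSemiring K𝔽] (X : Type v) : OpKit (pcSystem K𝔽 X) where
  op := PICircuit.mul
  comm F G := ⟨.A4, .inl (.a4 F G)⟩
  assoc F G H := ⟨.A5, .inl (.a5 F G H)⟩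
  congr h h₁ h₂ := h.congrMul h₁ h₂
  size_op := PICircuit.size_mul

/-- The operation of `addKit` is the disjoint sum. [folklore] -/
@[simp] theorem addKit_op : (addKit K𝔽 X).op = PICircuit.add := rfl

/-- The operation of `mulKit` is the disjoint product. [folklore] -/
@[simp] theorem mulKit_op : (mulKit K𝔽 X).op = PICircuit.mul := rfl

end PC

end PCR

open Literature.Computability.AlgebraicComplexity in
/-- **Bottom swap in `P_c(ℂ)`, `+` form** (registered helper toward the necessity of stub T′
`stub_invarianceProvableQP'`, crux `RestorationQP`): inside any proof DAG, the line
`(a + x) + y = (a + y) + x` is realized at cost `16·B` for any bound `B ≥ |(a + x) + y|`.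
[folklore] -/
theorem invarianceProvableQP_aux_swapBottom : ∀ (n : ℕ) (L : List (PICircuit ℂ (Fin n × Fin n) × PICircuit ℂ (Fin n × Fin n))) (m : ℕ) (a x y : PICircuit ℂ (Fin n × Fin n)) (B : ℕ), PCR.Real (pcSystem ℂ (Fin n × Fin n)) L m → (PICircuit.add (PICircuit.add a x) y).size ≤ B → PCR.Real (pcSystem ℂ (Fin n × Fin n)) ((PICircuit.add (PICircuit.add a x) y, PICircuit.add (PICircuit.add a y) x) :: L) (m + 16 * B) := by
  intro n L m a x y B h hB
  exact h.swapBottom (PCR.addKit ℂ (Fin n × Fin n)) a x y hB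

end Summit.ValiantsHypothesis.ValiantsHypothesis.Theorems
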